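import Summits.Ventures.PercRepro.Reveal
import Summits.Ventures.PercRepro.Classical

/-!
# The van den Berg–Kahn / van den Berg–Häggström–Kahn inequality (finite weight form)

For Bernoulli bond percolation on a finite multigraph `G`, a root vertex `s`, nonnegative
functions `f`, `g` of the configuration that are *determined by the open cluster of `s` and
increasing in it* (`G.ClusterMono s f`), and vertex sets `X`, `Y`, writing
`R_X = {s ↮ x for all x ∈ X}` (`G.sepAllEvent s X`) and `1_R f = R.indicator f`:

  `E[1_{R_X} f] · E[1_{R_Y} g] ≤ E[1_{R_{X ∩ Y}} f g] · P(R_{X ∪ Y})`   (`vanDenBergKahn_expect`)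

and, for events `A`, `B` determined by and increasing in the cluster of `s` (`G.ClusterDet s A`),

  `P(A ∩ R_X) · P(B ∩ R_Y) ≤ P(A ∩ B ∩ R_{X ∩ Y}) · P(R_{X ∪ Y})`           (`vanDenBergKahn`).

This is Theorem 1.1 of van den Berg–Häggström–Kahn, *Some conditional correlation inequalities
for percolation and related processes*, Random Struct. Alg. 29 (2006) (the case `A = Q_A`,
`B = Q_B` is Theorem 1.2 of van den Berg–Kahn, Ann. Probab. 29 (2001) 123–126); the function
form with `X = Y` is their Theorem 1.3, and `X = Y = {t}`, `A = {s ↔ a}`, `B = {s ↔ b}` is the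
conditional FKG inequality `P(s ↔ a, s ↔ b | s ↮ t) ≥ P(s ↔ a | s ↮ t) P(s ↔ b | s ↮ t)`
(van den Berg–Kahn Theorem 1.1, `conditional_fkg`).

The proof follows van den Berg–Kahn: Ahlswede–Daykin (Mathlib's `four_functions_theorem_univ`)
applied to the configuration of the edges incident to `Z = X ∩ Y`, plus an induction.  Instead
of deleting `Z` from the graph we keep the graph fixed and *zero the edge probabilities* of the
edges incident to `Z` (`zeroOn`, from `Support.lean`), inducting on the number of edges with
nonzero probability; the splitting identity and the path lemmas are in `Reveal.lean`.
-/

namespace PercRepro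

open Finset

/-! ### The inequality -/

namespace MultiGraph

variable {V E : Type*} {G : MultiGraph V E} [Fintype E] [DecidableEq E]

/-- Harris, mixed function form: for `f ≥ 0` monotone and `R` decreasing,
`E[1_R f] ≤ E[f] · P(R)`. -/
theorem expect_indicator_le_expect_mul_prob {p : E → ℝ} (hp : IsProb p) {f : Config E → ℝ}
    (hf0 : 0 ≤ f) (hf : Monotone f) {R : Set (Config E)} (hR : IsLowerSet R) :
    expect p (R.indicator f) ≤ expect p f * prob p R := by
  have h1 : expect p f = expect p (R.indicator f) + expect p (Rᶜ.indicator f) := by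
    rw [← expect_add, Set.indicator_self_add_compl]
  have h2 : expect p f * prob p Rᶜ ≤ expect p (Rᶜ.indicator f) := by
    have h := harris_expect hp (f := f) (g := Rᶜ.indicator 1) hf0
      (fun _ => Set.indicator_nonneg (fun _ _ => zero_le_one) _) hf
      (monotone_indicator_one hR.compl)
    rw [prob_eq_expect_indicator]
    convert h using 2
    funext ω
    by_cases hω : ω ∈ Rᶜ <;> simp [Set.indicator, hω]
  have h3 := prob_compl p R
  rw [h3, mul_sub, mul_one] at h2
  linarith

/-- `E[1_R f] ≥ 0` for `f ≥ 0`. -/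
theorem expect_indicator_nonneg {p : E → ℝ} (hp : IsProb p) {f : Config E → ℝ} (hf0 : 0 ≤ f)
    (R : Set (Config E)) : 0 ≤ expect p (R.indicator f) :=
  expect_nonneg hp fun _ => Set.indicator_nonneg (fun ω _ => hf0 ω) _

/-- **Disjoint case** `X ∩ Y = ∅`: four applications of the Harris inequality. -/
theorem vdbk_expect_of_disjoint (s : V) {p : E → ℝ} (hp : IsProb p) {f g : Config E → ℝ}
    (hf : G.ClusterMono s f) (hg : G.ClusterMono s g) (hf0 : 0 ≤ f) (hg0 : 0 ≤ g) {X Y : Set V}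
    (hXY : X ∩ Y = ∅) :
    expect p ((G.sepAllEvent s X).indicator f) * expect p ((G.sepAllEvent s Y).indicator g) ≤
      expect p ((G.sepAllEvent s (X ∩ Y)).indicator (f * g)) *
        prob p (G.sepAllEvent s (X ∪ Y)) := by
  rw [hXY, G.sepAllEvent_empty, Set.indicator_univ, G.sepAllEvent_union]
  have h1 := expect_indicator_le_expect_mul_prob hp hf0 hf.monotone (G.isLowerSet_sepAllEvent s X)
  have h2 := expect_indicator_le_expect_mul_prob hp hg0 hg.monotone (G.isLowerSet_sepAllEvent s Y)
  have h3 := harris_expect hp hf0 hg0 hf.monotone hg.monotone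
  have h4 := harris_lower hp (G.isLowerSet_sepAllEvent s X) (G.isLowerSet_sepAllEvent s Y)
  have hf0' : 0 ≤ expect p f := expect_nonneg hp hf0
  have hX0 := prob_nonneg hp (G.sepAllEvent s X)
  have hY0 := prob_nonneg hp (G.sepAllEvent s Y)
  calc expect p ((G.sepAllEvent s X).indicator f) * expect p ((G.sepAllEvent s Y).indicator g)
      ≤ (expect p f * prob p (G.sepAllEvent s X)) * (expect p g * prob p (G.sepAllEvent s Y)) :=
        mul_le_mul h1 h2 (expect_indicator_nonneg hp hg0 _) (mul_nonneg hf0' hX0)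
    _ = (expect p f * expect p g) * (prob p (G.sepAllEvent s X) * prob p (G.sepAllEvent s Y)) := by
        ring
    _ ≤ expect p (f * g) * prob p (G.sepAllEvent s X ∩ G.sepAllEvent s Y) :=
        mul_le_mul h3 h4 (mul_nonneg hX0 hY0) (expect_nonneg hp fun ω => mul_nonneg (hf0 ω) (hg0 ω))

/-- **Degenerate case**: no edge at `Z = X ∩ Y` has positive probability.  Then a.s. `s` does not
reach `Z`, and the inequality reduces to the disjoint case for `X \ Z`, `Y \ Z`. -/
theorem vdbk_expect_of_zero_incident (s : V) {p : E → ℝ} (hp : IsProb p) {f g : Config E → ℝ}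
    (hf : G.ClusterMono s f) (hg : G.ClusterMono s g) (hf0 : 0 ≤ f) (hg0 : 0 ≤ g) {X Y : Set V}
    (hs : s ∉ X ∩ Y) (h0 : ∀ e, (G.fst e ∈ X ∩ Y ∨ G.snd e ∈ X ∩ Y) → p e = 0) :
    expect p ((G.sepAllEvent s X).indicator f) * expect p ((G.sepAllEvent s Y).indicator g) ≤
      expect p ((G.sepAllEvent s (X ∩ Y)).indicator (f * g)) *
        prob p (G.sepAllEvent s (X ∪ Y)) := by
  set Z := X ∩ Y with hZ
  have hcl : ∀ ω : Config E, weight p ω ≠ 0 → ∀ e, ω e = true → G.fst e ∉ Z ∧ G.snd e ∉ Z := by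
    intro ω hω e he
    by_contra hcon
    have hpe : p e = 0 := h0 e (by tauto)
    have hfalse := eq_false_of_weight_ne_zero_of_eq_zero hω hpe
    simp [hfalse] at he
  have key : ∀ (F : Config E → ℝ) (W : Set V),
      expect p ((G.sepAllEvent s W).indicator F) =
        expect p ((G.sepAllEvent s (W \ Z)).indicator F) := by
    intro F W
    apply expect_congr_of_support
    intro ω hω
    have hiff := mem_sepAllEvent_iff_of_closed_incident hs (hcl ω hω) W
    by_cases h : ω ∈ G.sepAllEvent s W
    · rw [Set.indicator_of_mem h, Set.indicator_of_mem (hiff.1 h)]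
    · rw [Set.indicator_of_notMem h, Set.indicator_of_notMem (fun h' => h (hiff.2 h'))]
  have e4 : prob p (G.sepAllEvent s (X ∪ Y)) = prob p (G.sepAllEvent s ((X ∪ Y) \ Z)) := by
    apply prob_congr_of_support
    intro ω hω
    exact mem_sepAllEvent_iff_of_closed_incident hs (hcl ω hω) (X ∪ Y)
  rw [key f X, key g Y, key (f * g) Z, e4]
  have hdisj : (X \ Z) ∩ (Y \ Z) = ∅ := by
    ext v
    simp only [hZ, Set.mem_inter_iff, Set.mem_sdiff, Set.mem_empty_iff_false, iff_false]
    tauto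
  have hunion : (X ∪ Y) \ Z = (X \ Z) ∪ (Y \ Z) := Set.union_sdiff_distrib
  have hZZ : Z \ Z = ∅ := Set.sdiff_self
  rw [hZZ, ← hdisj, hunion]
  exact vdbk_expect_of_disjoint s hp hf hg hf0 hg0 hdisj

/-- **Inductive step**: reveal the configuration of the edges `K` at `Z = X ∩ Y`, apply
Ahlswede–Daykin (`four_functions_theorem_univ`) to the four resulting functions of the revealed
configuration, and use the inequality for `zeroOn p K` (given as `ih`) pointwise. -/
theorem vdbk_expect_step (s : V) {p : E → ℝ} (hp : IsProb p) {f g : Config E → ℝ}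
    (hf : G.ClusterMono s f) (hg : G.ClusterMono s g) (hf0 : 0 ≤ f) (hg0 : 0 ≤ g) {X Y : Set V}
    (hs : s ∉ X ∩ Y) {K : Finset E} (hK : ∀ e, e ∈ K ↔ (G.fst e ∈ X ∩ Y ∨ G.snd e ∈ X ∩ Y))
    (ih : ∀ X₁ Y₁ : Set V,
      expect (zeroOn p K) ((G.sepAllEvent s X₁).indicator f) *
          expect (zeroOn p K) ((G.sepAllEvent s Y₁).indicator g) ≤
        expect (zeroOn p K) ((G.sepAllEvent s (X₁ ∩ Y₁)).indicator (f * g)) *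
          prob (zeroOn p K) (G.sepAllEvent s (X₁ ∪ Y₁))) :
    expect p ((G.sepAllEvent s X).indicator f) * expect p ((G.sepAllEvent s Y).indicator g) ≤
      expect p ((G.sepAllEvent s (X ∩ Y)).indicator (f * g)) *
        prob p (G.sepAllEvent s (X ∪ Y)) := by
  have hsum : ∀ (F : Config E → ℝ), G.ClusterMono s F → ∀ (W : Set V), X ∩ Y ⊆ W →
      expect p ((G.sepAllEvent s W).indicator F) =
        ∑ ζ, weight (keepOn p K) ζ * expect (zeroOn p K)
          ((G.sepAllEvent s ((W \ (X ∩ Y)) ∪ G.exposed (X ∩ Y) ζ)).indicator F) := by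
    intro F hF W hZW
    rw [expect_eq_sum_keepOn p K]
    refine Finset.sum_congr rfl fun ζ _ => ?_
    by_cases hwζ : weight (keepOn p K) ζ = 0
    · rw [hwζ, zero_mul, zero_mul]
    · rw [G.expect_zeroOn_sup_eq s hs hK p (fun _ _ h => hF.eq_of_cluster_eq h) hZW
        (closedOff_of_weight_keepOn_ne_zero hwζ)]
  set Z := X ∩ Y with hZ
  set p' := zeroOn p K with hp'
  have hp'P : IsProb p' := isProb_zeroOn hp K
  have hwP : IsProb (keepOn p K) := isProb_keepOn hp K
  set w := weight (keepOn p K) with hw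
  set S := G.exposed Z with hS
  have hfg0 : 0 ≤ f * g := fun ω => mul_nonneg (hf0 ω) (hg0 ω)
  have h1 := hsum f hf X Set.inter_subset_left
  have h2 := hsum g hg Y Set.inter_subset_right
  have h3 := hsum (f * g) (hf.mul hg hf0 hg0) Z subset_rfl
  have h4 : prob p (G.sepAllEvent s (X ∪ Y)) =
      ∑ ζ, w ζ * expect p' ((G.sepAllEvent s (((X ∪ Y) \ Z) ∪ S ζ)).indicator 1) := by
    rw [prob_eq_expect_indicator]
    exact hsum 1 (clusterMono_const s 1) (X ∪ Y)
      (Set.inter_subset_left.trans Set.subset_union_left)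
  rw [h1, h2, h3, h4]
  have h10 : (0 : Config E → ℝ) ≤ 1 := fun _ => zero_le_one
  refine four_functions_theorem_univ _ _ _ _
    (fun ζ => mul_nonneg (weight_nonneg hwP ζ) (expect_indicator_nonneg hp'P hf0 _))
    (fun ζ => mul_nonneg (weight_nonneg hwP ζ) (expect_indicator_nonneg hp'P hg0 _))
    (fun ζ => mul_nonneg (weight_nonneg hwP ζ) (expect_indicator_nonneg hp'P hfg0 _))
    (fun ζ => mul_nonneg (weight_nonneg hwP ζ) (expect_indicator_nonneg hp'P h10 _))
    fun ζ ζ' => ?_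
  have hlm : w ζ * w ζ' = w (ζ ⊓ ζ') * w (ζ ⊔ ζ') := weight_inf_mul_weight_sup _ ζ ζ'
  have hih := ih ((X \ Z) ∪ S ζ) ((Y \ Z) ∪ S ζ')
  rw [prob_eq_expect_indicator] at hih
  have hmono : expect p' ((G.sepAllEvent s (((X \ Z) ∪ S ζ) ∩ ((Y \ Z) ∪ S ζ'))).indicator
        (f * g)) ≤ expect p' ((G.sepAllEvent s ((Z \ Z) ∪ S (ζ ⊓ ζ'))).indicator (f * g)) := by
    refine expect_mono hp'P fun ω => Set.indicator_le_indicator_of_subset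
      (G.sepAllEvent_anti s ?_) hfg0 ω
    rw [Set.sdiff_self, Set.empty_union]
    intro v hv
    have hv' := G.exposed_inf_subset Z ζ ζ' hv
    exact ⟨Or.inr hv'.1, Or.inr hv'.2⟩
  have hunion : ((X \ Z) ∪ S ζ) ∪ ((Y \ Z) ∪ S ζ') = ((X ∪ Y) \ Z) ∪ S (ζ ⊔ ζ') := by
    rw [hS, G.exposed_sup]
    ext v
    simp only [Set.mem_union, Set.mem_sdiff]
    tauto
  have hw0 : 0 ≤ w ζ * w ζ' := mul_nonneg (weight_nonneg hwP ζ) (weight_nonneg hwP ζ')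
  have hP4 : 0 ≤ expect p' ((G.sepAllEvent s (((X \ Z) ∪ S ζ) ∪ ((Y \ Z) ∪ S ζ'))).indicator 1) :=
    expect_indicator_nonneg hp'P h10 _
  rw [← hunion]
  calc w ζ * expect p' ((G.sepAllEvent s ((X \ Z) ∪ S ζ)).indicator f) *
        (w ζ' * expect p' ((G.sepAllEvent s ((Y \ Z) ∪ S ζ')).indicator g))
      = (w ζ * w ζ') * (expect p' ((G.sepAllEvent s ((X \ Z) ∪ S ζ)).indicator f) *
          expect p' ((G.sepAllEvent s ((Y \ Z) ∪ S ζ')).indicator g)) := by ring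
    _ ≤ (w ζ * w ζ') *
          (expect p' ((G.sepAllEvent s (((X \ Z) ∪ S ζ) ∩ ((Y \ Z) ∪ S ζ'))).indicator (f * g)) *
            expect p' ((G.sepAllEvent s (((X \ Z) ∪ S ζ) ∪ ((Y \ Z) ∪ S ζ'))).indicator 1)) :=
        mul_le_mul_of_nonneg_left hih hw0
    _ ≤ (w ζ * w ζ') *
          (expect p' ((G.sepAllEvent s ((Z \ Z) ∪ S (ζ ⊓ ζ'))).indicator (f * g)) *
            expect p' ((G.sepAllEvent s (((X \ Z) ∪ S ζ) ∪ ((Y \ Z) ∪ S ζ'))).indicator 1)) :=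
        mul_le_mul_of_nonneg_left (mul_le_mul_of_nonneg_right hmono hP4) hw0
    _ = w (ζ ⊓ ζ') * expect p' ((G.sepAllEvent s ((Z \ Z) ∪ S (ζ ⊓ ζ'))).indicator (f * g)) *
          (w (ζ ⊔ ζ') *
            expect p' ((G.sepAllEvent s (((X \ Z) ∪ S ζ) ∪ ((Y \ Z) ∪ S ζ'))).indicator 1)) := by
        rw [hlm]
        ring

/-- **The van den Berg–Kahn / van den Berg–Häggström–Kahn inequality, function form.**  For a
vertex `s`, nonnegative functions `f`, `g` determined by and increasing in the open cluster of `s`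
(`G.ClusterMono s`), and vertex sets `X`, `Y`, with `R_X = {s ↮ x for all x ∈ X}`:

  `E[1_{R_X} f] · E[1_{R_Y} g] ≤ E[1_{R_{X ∩ Y}} f g] · P(R_{X ∪ Y})`

(van den Berg–Häggström–Kahn 2006, Theorem 1.1 / 1.3).  Proof: induction on the number of
edges of nonzero probability; reveal the edges at `Z = X ∩ Y` and apply Ahlswede–Daykin. -/
theorem vanDenBergKahn_expect (s : V) {f g : Config E → ℝ} (hf : G.ClusterMono s f)
    (hg : G.ClusterMono s g) (hf0 : 0 ≤ f) (hg0 : 0 ≤ g) {p : E → ℝ} (hp : IsProb p)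
    (X Y : Set V) :
    expect p ((G.sepAllEvent s X).indicator f) * expect p ((G.sepAllEvent s Y).indicator g) ≤
      expect p ((G.sepAllEvent s (X ∩ Y)).indicator (f * g)) *
        prob p (G.sepAllEvent s (X ∪ Y)) := by
  classical
  suffices H : ∀ n : ℕ, ∀ p : E → ℝ, (univ.filter fun e => p e ≠ 0).card = n → IsProb p →
      ∀ X Y : Set V,
        expect p ((G.sepAllEvent s X).indicator f) * expect p ((G.sepAllEvent s Y).indicator g) ≤
          expect p ((G.sepAllEvent s (X ∩ Y)).indicator (f * g)) *
            prob p (G.sepAllEvent s (X ∪ Y)) from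
    H _ p rfl hp X Y
  intro n
  induction n using Nat.strong_induction_on with
  | _ n ih =>
    intro p hn hp X Y
    by_cases hs : s ∈ X ∪ Y
    · have hz : ∀ (F : Config E → ℝ) (W : Set V), s ∈ W →
          expect p ((G.sepAllEvent s W).indicator F) = 0 := by
        intro F W hW
        rw [G.sepAllEvent_eq_empty_of_mem hW, Set.indicator_empty]
        exact expect_const p 0
      rcases hs with hs | hs
      · rw [hz f X hs, zero_mul]
        exact mul_nonneg (expect_indicator_nonneg hp (fun ω => mul_nonneg (hf0 ω) (hg0 ω)) _)
          (prob_nonneg hp _)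
      · rw [hz g Y hs, mul_zero]
        exact mul_nonneg (expect_indicator_nonneg hp (fun ω => mul_nonneg (hf0 ω) (hg0 ω)) _)
          (prob_nonneg hp _)
    · have hs' : s ∉ X ∩ Y := fun h => hs (Or.inl h.1)
      set K : Finset E := univ.filter fun e => G.fst e ∈ X ∩ Y ∨ G.snd e ∈ X ∩ Y with hKdef
      have hK : ∀ e, e ∈ K ↔ (G.fst e ∈ X ∩ Y ∨ G.snd e ∈ X ∩ Y) := by
        intro e
        simp [hKdef]
      by_cases hc : ∃ e ∈ K, p e ≠ 0
      · refine vdbk_expect_step s hp hf hg hf0 hg0 hs' hK fun X₁ Y₁ => ?_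
        have hlt : (univ.filter fun e => zeroOn p K e ≠ 0).card < n := by
          rw [← hn]
          apply Finset.card_lt_card
          rw [Finset.ssubset_iff_of_subset]
          · obtain ⟨e, heK, hpe⟩ := hc
            exact ⟨e, by simpa using hpe, by simp [zeroOn_apply_of_mem p heK]⟩
          · intro e he
            simp only [Finset.mem_filter, Finset.mem_univ, true_and] at he ⊢
            intro h0
            apply he
            by_cases heK : e ∈ K
            · exact zeroOn_apply_of_mem p heK
            · rw [zeroOn_apply_of_notMem p heK, h0]
        exact ih _ hlt (zeroOn p K) rfl (isProb_zeroOn hp K) X₁ Y₁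
      · refine vdbk_expect_of_zero_incident s hp hf hg hf0 hg0 hs' fun e he => ?_
        by_contra hne
        exact hc ⟨e, (hK e).2 he, hne⟩

/-! ### Event form and corollaries -/

/-- `1_R (1_A) = 1_{A ∩ R}`, with the expectation read as a probability. -/
theorem expect_indicator_indicator_one (p : E → ℝ) (A R : Set (Config E)) :
    expect p (R.indicator (A.indicator 1)) = prob p (A ∩ R) := by
  rw [Set.indicator_indicator, Set.inter_comm, expect_indicator_one]

/-- **The van den Berg–Kahn / van den Berg–Häggström–Kahn inequality.**  For a vertex `s`, events
`A`, `B` determined by and increasing in the open cluster of `s` (`G.ClusterDet s`), and vertex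
sets `X`, `Y`, with `R_X = {s ↮ x for all x ∈ X}`:

  `P(A ∩ R_X) · P(B ∩ R_Y) ≤ P(A ∩ B ∩ R_{X ∩ Y}) · P(R_{X ∪ Y})`

(van den Berg–Häggström–Kahn 2006, Theorem 1.1; van den Berg–Kahn 2001, Theorem 1.2 for
`A = {s ↔ a, a ∈ 𝒜}`, `B = {s ↔ b, b ∈ ℬ}`). -/
theorem vanDenBergKahn (s : V) {A B : Set (Config E)} (hA : G.ClusterDet s A)
    (hB : G.ClusterDet s B) {p : E → ℝ} (hp : IsProb p) (X Y : Set V) :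
    prob p (A ∩ G.sepAllEvent s X) * prob p (B ∩ G.sepAllEvent s Y) ≤
      prob p (A ∩ B ∩ G.sepAllEvent s (X ∩ Y)) * prob p (G.sepAllEvent s (X ∪ Y)) := by
  have h := G.vanDenBergKahn_expect s hA.clusterMono_indicator hB.clusterMono_indicator
    (fun _ => Set.indicator_nonneg (fun _ _ => zero_le_one) _)
    (fun _ => Set.indicator_nonneg (fun _ _ => zero_le_one) _) hp X Y
  rwa [← Set.inter_indicator_one, expect_indicator_indicator_one, expect_indicator_indicator_one,
    expect_indicator_indicator_one] at h

/-- **van den Berg–Häggström–Kahn (2006), Theorem 1.3**: conditionally on `s ↮ X`, two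
nonnegative cluster-increasing functions of `C_s` are positively correlated,
`E[1_{R_X} f] · E[1_{R_X} g] ≤ E[1_{R_X} f g] · P(R_X)`. -/
theorem conditional_fkg_expect (s : V) {f g : Config E → ℝ} (hf : G.ClusterMono s f)
    (hg : G.ClusterMono s g) (hf0 : 0 ≤ f) (hg0 : 0 ≤ g) {p : E → ℝ} (hp : IsProb p)
    (X : Set V) :
    expect p ((G.sepAllEvent s X).indicator f) * expect p ((G.sepAllEvent s X).indicator g) ≤
      expect p ((G.sepAllEvent s X).indicator (f * g)) * prob p (G.sepAllEvent s X) := by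
  simpa using G.vanDenBergKahn_expect s hf hg hf0 hg0 hp X X

/-- **Theorem 1.3, mixed form**: conditionally on `s ↮ X`, a nonnegative cluster-increasing
function `f` and a cluster-decreasing function `h` with `0 ≤ h ≤ M` are negatively correlated,
`E[1_{R_X} f h] · P(R_X) ≤ E[1_{R_X} f] · E[1_{R_X} h]`. -/
theorem conditional_fkg_expect_anti (s : V) {f h : Config E → ℝ} (hf : G.ClusterMono s f)
    (hh : G.ClusterAnti s h) (hf0 : 0 ≤ f) {M : ℝ} (hhM : ∀ ω, h ω ≤ M) {p : E → ℝ}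
    (hp : IsProb p) (X : Set V) :
    expect p ((G.sepAllEvent s X).indicator (f * h)) * prob p (G.sepAllEvent s X) ≤
      expect p ((G.sepAllEvent s X).indicator f) * expect p ((G.sepAllEvent s X).indicator h) := by
  set R := G.sepAllEvent s X with hR
  have key := G.conditional_fkg_expect s hf (hh.const_sub M) hf0
    (fun ω => sub_nonneg.2 (hhM ω)) hp X
  -- expand the two expectations involving `M - h`
  have e1 : expect p (R.indicator fun ω => M - h ω) =
      M * prob p R - expect p (R.indicator h) := by
    rw [prob_eq_expect_indicator, ← expect_const_mul, ← expect_sub]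
    congr 1
    funext ω
    by_cases hω : ω ∈ R <;> simp [Set.indicator, hω]
  have e2 : expect p (R.indicator (f * fun ω => M - h ω)) =
      M * expect p (R.indicator f) - expect p (R.indicator (f * h)) := by
    rw [← expect_const_mul, ← expect_sub]
    congr 1
    funext ω
    by_cases hω : ω ∈ R <;> simp [Set.indicator, hω]
    ring
  rw [e1, e2] at key
  nlinarith [key]

/-- **van den Berg–Kahn (2001), Theorem 1.1** (conditional FKG): conditionally on `s ↮ t`, the
connection events `s ↔ a` and `s ↔ b` are positively correlated,
`P(s ↔ a, s ↔ b, s ↮ t) · P(s ↮ t) ≥ P(s ↔ a, s ↮ t) · P(s ↔ b, s ↮ t)`. -/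
theorem conditional_fkg (s a b t : V) {p : E → ℝ} (hp : IsProb p) :
    prob p (G.connEvent s a ∩ G.sepEvent s t) * prob p (G.connEvent s b ∩ G.sepEvent s t) ≤
      prob p (G.connEvent s a ∩ G.connEvent s b ∩ G.sepEvent s t) * prob p (G.sepEvent s t) := by
  have h := G.vanDenBergKahn s (G.clusterDet_connEvent s a) (G.clusterDet_connEvent s b) hp {t} {t}
  simpa [G.sepAllEvent_singleton s t] using h

/-- **Log-supermodularity of the avoidance probabilities** (van den Berg–Häggström–Kahn 2006,
Remark (ii) in §3): `P(R_X) · P(R_Y) ≤ P(R_{X ∩ Y}) · P(R_{X ∪ Y})`. -/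
theorem prob_sepAllEvent_mul_le (s : V) {p : E → ℝ} (hp : IsProb p) (X Y : Set V) :
    prob p (G.sepAllEvent s X) * prob p (G.sepAllEvent s Y) ≤
      prob p (G.sepAllEvent s (X ∩ Y)) * prob p (G.sepAllEvent s (X ∪ Y)) := by
  have h := G.vanDenBergKahn s (G.clusterDet_univ s) (G.clusterDet_univ s) hp X Y
  simpa using h

end MultiGraph

end PercRepro
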